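import Mathlib.NumberTheory.NumberField.Cyclotomic.PID
import Mathlib.NumberTheory.NumberField.Cyclotomic.Ideal
import Mathlib.RingTheory.Polynomial.Cyclotomic.Expand
import Mathlib.Analysis.Real.Pi.Bounds
import Mathlib.RingTheory.ZMod
import Mathlib.Tactic.NormNum.Prime
import HarnessLib

/-!
# `ℚ(ζ₂₀)` has class number one: `ℤ[ζ₂₀]` is a principal ideal domain

Topic `Literature/NumberTheory/NumberFields`, namespace `Literature.NumberTheory.NumberFields`.  Theorems only; no
definition, no named fact (net Literature debt 0).  Companion of `CyclotomicFieldFifteenClassNumber` (the other cyclotomic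
field of degree `8` with two ramified primes; `ℚ(ζ₁₆)` is `CyclotomicFieldsEightSixteenClassNumber`): `ℚ(ζ₂₀) = ℚ(i)ℚ(ζ₅)`,
degree `8`, discriminant `d = 2⁸ · 5⁶ = 4000000 = 2000²` (Mathlib's general `IsCyclotomicExtension.Rat.discr`), Minkowski
constant `M_K = (4/π)⁴ · (8!/8⁸) · 2000 ≈ 12.66 < 13` (with `π > 3.14`).  By the splitting law (Marcus Thm. 26 / Washington
Thm. 2.13; Mathlib `inertiaDeg_eq_of_not_dvd`, `inertiaDeg_eq`) the residue degrees of the primes `p ≤ 12` are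
`f(2) = ord₅(2) = 4` (`20 = 2²·5`; norm `16`), `f(3) = ord₂₀(3) = 4` (`81`), `f(7) = ord₂₀(7) = 4` (`2401`), `f(11) = ord₂₀(11) = 2`
(`121`), all `> 12` — and `f(5) = ord₄(5) = 1`: the two primes above `5` have norm `5`, so ONE principal generator is needed.
It is `π = 1 + ζ − ζ³`: the reduction `ℤ[ζ] → 𝔽₅`, `ζ ↦ 2` (`Φ₂₀ ≡ (X² + 1)⁴ (mod 5)`, `2² + 1 ≡ 0`) has kernel `(5, ζ − 2)`,
and the identities in `ℤ[ζ] = ℤ[X]/(Φ₂₀)`, `Φ₂₀ = X⁸ − X⁶ + X⁴ − X² + 1`,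

  `(1 + ζ − ζ³)(2 + ζ + ζ² − 2ζ³ + ζ⁴ + 3ζ⁵ − 3ζ⁶ + ζ⁷) = 5`,  `(1 + ζ − ζ³)(−1 + ζ³ − ζ⁴ − ζ⁵ + 2ζ⁶ − ζ⁷) = ζ − 2`

(verified by `linear_combination` against `Φ₂₀(ζ) = 0`, which is `ζ¹⁰ = −1`, `ζ² ≠ −1`) show `(5, ζ − 2) = (π)`: a principal
prime of residue degree `1` above `5`.  Mathlib's Galois-case criterion
`RingOfIntegers.isPrincipalIdealRing_of_isPrincipal_of_lt_or_isPrincipal_of_mem_primesOver_of_mem_Icc` then gives `h = 1`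
(an entry of Masley–Montgomery's list, Washington Thm. 11.1).

* `discr_of_isCyclotomicExtension_twenty` (`4000000`), `minkowskiBound_lt_thirteen_of_isCyclotomicExtension_twenty`,
  `toInteger_pow_eight_sub_eq_zero_twenty` (`Φ₂₀(ζ) = 0` in `𝓞_K`, spelled out),
  **`span_one_add_zeta_sub_zeta_pow_three_mem_primesOver_twenty`** (`(1 + ζ − ζ³)` is a prime of `𝓞_K` above `5`),
  **`classNumber_eq_one_of_isCyclotomicExtension_twenty`**, `isPrincipalIdealRing_adjoin_of_isPrimitiveRoot_twenty` (`ℤ[ζ₂₀]`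
  is a PID), `isPrincipalIdealRing_ringOfIntegers_cyclotomicField_twenty`, `classNumber_cyclotomicField_twenty`.

Consumers: complex `4`-tori with an endomorphism of characteristic polynomial `Φ₂₀` (`φ(20) = 8`).

## References

* [Washington1997] L. C. Washington, *Introduction to Cyclotomic Fields*, 2nd ed., GTM 83 (1997), Thm. 11.1
  (Masley–Montgomery), Prop. 2.7 (discriminant), Thm. 2.13 (splitting of primes).
* [Marcus2018] D. A. Marcus, *Number Fields*, 2nd ed. (2018), Ch. 3 Thm. 26 and Thm. 27 (chunk p0064), Ch. 5 Thm. 37 Cor. 2 (p0107).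
* [MasleyMontgomery1976] J. M. Masley, H. L. Montgomery, *Cyclotomic fields with unique factorization*, J. reine angew.
  Math. 286/287 (1976) 248–256.
-/

noncomputable section

namespace Literature.NumberTheory.NumberFields

open NumberField NumberField.InfinitePlace Polynomial Nat Real IsCyclotomicExtension.Rat Ideal
open scoped Real

section Twenty

variable (K : Type) [Field K] [NumberField K] [IsCyclotomicExtension {20} ℚ K]

/-- **The discriminant of `ℚ(ζ₂₀)` is `2⁸ · 5⁶ = 4000000`** (`(−1)^{φ(20)/2} 20⁸ / (2^{8/1} 5^{8/4})`). [cite: Washington1997, Prop. 2.7] -/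
theorem discr_of_isCyclotomicExtension_twenty : NumberField.discr K = 4000000 := by
  have h := IsCyclotomicExtension.Rat.discr 20 K
  have hφ : Nat.totient 20 = 8 := by decide
  have hpf : (20 : ℕ).primeFactors = {2, 5} := by
    rw [show (20 : ℕ) = 2 ^ 2 * 5 from rfl, Nat.primeFactors_mul (by norm_num) (by norm_num),
      Nat.primeFactors_prime_pow (by norm_num) Nat.prime_two, Nat.Prime.primeFactors Nat.prime_five]
    rfl
  rw [hφ, hpf, Finset.prod_pair (by norm_num)] at h
  rw [h]
  norm_num

/-- **The Minkowski constant of `ℚ(ζ₂₀)` is `< 13`**: `(4/π)⁴ · (8!/8⁸) · √4000000 < (4/3.14)⁴ · (315/131072) · 2000 < 13`.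
[cite: Marcus2018, Ch. 5 Thm. 37 Cor. 2 (p0107)] -/
theorem minkowskiBound_lt_thirteen_of_isCyclotomicExtension_twenty :
    (4 / π) ^ nrComplexPlaces K * ((Module.finrank ℚ K)! / (Module.finrank ℚ K) ^ (Module.finrank ℚ K) *
      √|(NumberField.discr K : ℝ)|) < 13 := by
  rw [discr_of_isCyclotomicExtension_twenty K, IsCyclotomicExtension.finrank (n := 20) K
    (cyclotomic.irreducible_rat (by norm_num)), nrComplexPlaces_eq_totient_div_two 20,
    show Nat.totient 20 = 8 by decide]
  have hπ : 4 / π < 4 / 3.14 := by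
    apply div_lt_div_of_pos_left (by norm_num) (by norm_num) pi_gt_d2
  have hπ0 : 0 ≤ 4 / π := by positivity
  have h4 : (4 / π) ^ (8 / 2) < (4 / 3.14 : ℝ) ^ (8 / 2) := by
    rw [show (8 / 2 : ℕ) = 4 by norm_num]
    gcongr
  have hsqrt : √|((4000000 : ℤ) : ℝ)| = 2000 := by
    rw [show |((4000000 : ℤ) : ℝ)| = 2000 ^ 2 by norm_num, Real.sqrt_sq (by norm_num)]
  have hfac : ((8 : ℕ)! : ℝ) / (8 : ℕ) ^ (8 : ℕ) = 315 / 131072 := by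
    rw [show (8 : ℕ)! = 40320 by rfl]
    norm_num
  rw [hfac, hsqrt]
  calc (4 / π) ^ (8 / 2) * (315 / 131072 * (2000 : ℝ))
      ≤ (4 / 3.14 : ℝ) ^ (8 / 2) * (315 / 131072 * 2000) := by
        gcongr
    _ < 13 := by norm_num

variable {K} in
omit [NumberField K] [IsCyclotomicExtension {20} ℚ K] in
/-- **`Φ₂₀(ζ) = 0` in `𝓞_K`, spelled out**: `ζ⁸ − ζ⁶ + ζ⁴ − ζ² + 1 = 0` for a primitive `20`-th root of unity `ζ` (`ζ¹⁰ = −1` and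
`ζ² ≠ −1`, `X¹⁰ + 1 = (X² + 1) Φ₂₀`). [cite: Washington1997, Ch. 2 (cyclotomic polynomials)] -/
theorem toInteger_pow_eight_sub_eq_zero_twenty {ζ : K} (hζ : IsPrimitiveRoot ζ 20) :
    hζ.toInteger ^ 8 - hζ.toInteger ^ 6 + hζ.toInteger ^ 4 - hζ.toInteger ^ 2 + 1 = 0 := by
  set z : 𝓞 K := hζ.toInteger with hz
  have hz' : IsPrimitiveRoot z 20 := hζ.toInteger_isPrimitiveRoot
  have h20 : z ^ 20 = 1 := hz'.pow_eq_one
  have h10 : z ^ 10 ≠ 1 := hz'.pow_ne_one_of_pos_of_lt (by norm_num) (by norm_num)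
  have h4 : z ^ 4 ≠ 1 := hz'.pow_ne_one_of_pos_of_lt (by norm_num) (by norm_num)
  have h10' : z ^ 10 + 1 = 0 := by
    have hprod : (z ^ 10 - 1) * (z ^ 10 + 1) = 0 := by linear_combination h20
    rcases mul_eq_zero.1 hprod with h | h
    · exact absurd (sub_eq_zero.1 h) h10
    · exact h
  have h2 : z ^ 2 + 1 ≠ 0 := by
    intro h
    apply h4
    linear_combination (z ^ 2 - 1) * h
  have hprod : (z ^ 2 + 1) * (z ^ 8 - z ^ 6 + z ^ 4 - z ^ 2 + 1) = 0 := by linear_combination h10'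
  rcases mul_eq_zero.1 hprod with h | h
  · exact absurd h h2
  · exact h

/-- **The cyclotomic polynomial `Φ₂₀ = X⁸ − X⁶ + X⁴ − X² + 1`** (from `X¹⁰ + 1 = Φ₂₀ · Φ₄`, Mathlib's
`cyclotomic_expand_eq_cyclotomic_mul`, and `Φ₄ = X² + 1`). [cite: Washington1997, Ch. 2 (cyclotomic polynomials)] -/
theorem cyclotomic_twenty_int : cyclotomic 20 ℤ = X ^ 8 - X ^ 6 + X ^ 4 - X ^ 2 + 1 := by
  have h4 : cyclotomic 4 ℤ = X ^ 2 + 1 := by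
    rw [show (4 : ℕ) = 2 ^ (1 + 1) by norm_num, cyclotomic_prime_pow_eq_geom_sum Nat.prime_two]
    simp [Finset.sum_range_succ]
    ring
  have h := cyclotomic_expand_eq_cyclotomic_mul Nat.prime_five (by norm_num : ¬ 5 ∣ 4) ℤ
  rw [show (4 * 5 : ℕ) = 20 by norm_num, h4] at h
  have hexp : expand ℤ 5 (X ^ 2 + 1 : ℤ[X]) = X ^ 10 + 1 := by
    simp [expand_X]
    ring
  rw [hexp] at h
  have hne : (X ^ 2 + 1 : ℤ[X]) ≠ 0 := (monic_X_pow_add_C 1 two_ne_zero).ne_zero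
  apply mul_right_cancel₀ hne
  rw [← h]
  ring

variable {K} in
/-- **THE PRINCIPAL PRIME `(1 + ζ − ζ³)` OF `𝓞_{ℚ(ζ₂₀)}` ABOVE `5`**: for a primitive `20`-th root of unity `ζ`, the ideal
`(1 + ζ − ζ³)` of `𝓞_K` is prime and lies over `5` — it is the kernel `(5, ζ − 2)` of the reduction `ℤ[ζ] → 𝔽₅`, `ζ ↦ 2`
(`Φ₂₀(2) = 205 ≡ 0`), by the identities `(1 + ζ − ζ³)·β = 5`, `(1 + ζ − ζ³)·γ = ζ − 2` in `ℤ[ζ]` recorded in the module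
docstring (so `N(1 + ζ − ζ³) = 5`; `5` has residue degree `ord₄(5) = 1` in `ℚ(ζ₂₀)`). [cite: Marcus2018, Ch. 3 Thm. 26 and Thm. 27 (p0064)]
[cite: Washington1997, Thm. 2.13] -/
theorem span_one_add_zeta_sub_zeta_pow_three_mem_primesOver_twenty {ζ : K} (hζ : IsPrimitiveRoot ζ 20) :
    Ideal.span {1 + hζ.toInteger - hζ.toInteger ^ 3} ∈ primesOver (span {((5 : ℕ) : ℤ)}) (𝓞 K) := by
  -- arithmetic in `𝔽₅`, before any local `Fact` enters the context
  have hy0 : (2 ^ 8 - 2 ^ 6 + 2 ^ 4 - 2 ^ 2 + 1 : ZMod 5) = 0 := by decide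
  have hα0 : (1 + 2 - 2 ^ 3 : ZMod 5) = 0 := by decide
  -- the reduction map `red : 𝓞 K → 𝔽₅`, `ζ ↦ 2`
  have hy : aeval (2 : ZMod 5) (minpoly ℤ hζ.integralPowerBasis.gen) = 0 := by
    rw [hζ.integralPowerBasis_gen, ← NumberField.RingOfIntegers.minpoly_coe]
    change aeval (2 : ZMod 5) (minpoly ℤ ζ) = 0
    rw [← cyclotomic_eq_minpoly hζ (by norm_num), cyclotomic_twenty_int]
    simpa using hy0
  set red : 𝓞 K →+* ZMod 5 := (hζ.integralPowerBasis.lift (2 : ZMod 5) hy).toRingHom with hred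
  set z : 𝓞 K := hζ.toInteger with hz
  have hφz : red z = 2 := by
    rw [hred, hz, ← hζ.integralPowerBasis_gen]
    exact hζ.integralPowerBasis.lift_gen 2 hy
  -- `Φ₂₀(ζ) = 0` in `𝓞 K`
  have hΦ : z ^ 8 - z ^ 6 + z ^ 4 - z ^ 2 + 1 = 0 := by
    rw [hz]
    exact toInteger_pow_eight_sub_eq_zero_twenty hζ
  -- the two certificates
  have h5 : (1 + z - z ^ 3) * (2 + z + z ^ 2 - 2 * z ^ 3 + z ^ 4 + 3 * z ^ 5 - 3 * z ^ 6 + z ^ 7) = 5 := by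
    linear_combination (-3 + 3 * z - z ^ 2) * hΦ
  have h2 : (1 + z - z ^ 3) * (-1 + z ^ 3 - z ^ 4 - z ^ 5 + 2 * z ^ 6 - z ^ 7) = z - 2 := by
    linear_combination (1 - 2 * z + z ^ 2) * hΦ
  -- `ker red = (1 + ζ − ζ³)`
  have hφα : red (1 + z - z ^ 3) = 0 := by
    rw [map_sub, map_add, map_one, map_pow, hφz]
    exact hα0
  have hker : RingHom.ker red = Ideal.span {1 + z - z ^ 3} := by
    apply le_antisymm
    · intro x hx
      rw [RingHom.mem_ker] at hx
      obtain ⟨g, hg⟩ := hζ.integralPowerBasis.exists_eq_aeval' x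
      rw [hζ.integralPowerBasis_gen, ← hz] at hg
      have hdec := modByMonic_add_div g (X - C (2 : ℤ))
      rw [modByMonic_X_sub_C_eq_C_eval] at hdec
      have hx' : x = ((g.eval 2 : ℤ) : 𝓞 K) + (z - 2) * aeval z (g /ₘ (X - C 2)) := by
        rw [hg]
        conv_lhs => rw [← hdec]
        simp only [map_add, map_mul, map_sub, map_intCast, map_ofNat, aeval_X, eq_intCast]
      have hc : ((g.eval 2 : ℤ) : ZMod 5) = 0 := by
        have h := hx
        rw [hx', map_add, map_mul, map_sub, map_intCast, hφz, map_ofNat, sub_self, zero_mul, add_zero] at h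
        exact h
      obtain ⟨m, hm⟩ := (ZMod.intCast_zmod_eq_zero_iff_dvd _ 5).1 hc
      rw [hx', hm, Int.cast_mul, Int.cast_natCast]
      refine Ideal.add_mem _ ?_ ?_
      · rw [show ((5 : ℕ) : 𝓞 K) = 5 from rfl, ← h5, mul_assoc]
        exact Ideal.mul_mem_right _ _ (Ideal.subset_span rfl)
      · rw [← h2, mul_assoc]
        exact Ideal.mul_mem_right _ _ (Ideal.subset_span rfl)
    · rw [Ideal.span_le, Set.singleton_subset_iff]
      exact hφα
  -- conclusion: `ker red` is prime (`𝔽₅` is a domain) and lies over `ker (ℤ → 𝔽₅) = (5)`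
  haveI : Fact (Nat.Prime 5) := ⟨Nat.prime_five⟩
  rw [← hker]
  refine ⟨RingHom.ker_isPrime red, ⟨?_⟩⟩
  rw [Ideal.under_def, RingHom.comap_ker, RingHom.ext_int (red.comp (algebraMap ℤ (𝓞 K))) (Int.castRingHom (ZMod 5)),
    ZMod.ker_intCastRingHom]

/-- `𝓞_K` is a principal ideal domain for a `20`-th cyclotomic extension `K/ℚ` (the Minkowski-bound argument; public form:
`classNumber_eq_one_of_isCyclotomicExtension_twenty`). [cite: Marcus2018, Ch. 5 Thm. 37 Cor. 2 (p0107) and Ch. 3 Thm. 26 (p0064)] -/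
private theorem isPrincipalIdealRing_ringOfIntegers_twenty_aux : IsPrincipalIdealRing (𝓞 K) := by
  -- Thm. 26 data (closed terms, before any `Fact (Nat.Prime _)` enters the context)
  have h2 : orderOf (2 : ZMod 5) = 4 :=
    (orderOf_eq_iff (by norm_num)).2 ⟨by decide, fun m hm h0 ↦ by interval_cases m <;> decide⟩
  have h3 : orderOf (3 : ZMod 20) = 4 :=
    (orderOf_eq_iff (by norm_num)).2 ⟨by decide, fun m hm h0 ↦ by interval_cases m <;> decide⟩
  have h7 : orderOf (7 : ZMod 20) = 4 :=
    (orderOf_eq_iff (by norm_num)).2 ⟨by decide, fun m hm h0 ↦ by interval_cases m <;> decide⟩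
  have h11 : orderOf (11 : ZMod 20) = 2 :=
    (orderOf_eq_iff (by norm_num)).2 ⟨by decide, fun m hm h0 ↦ by interval_cases m; decide⟩
  haveI : IsGalois ℚ K := IsCyclotomicExtension.isGalois {20} ℚ K
  have hM := minkowskiBound_lt_thirteen_of_isCyclotomicExtension_twenty K
  have hfloor : ⌊(4 / π) ^ nrComplexPlaces K * ((Module.finrank ℚ K)! / (Module.finrank ℚ K) ^ (Module.finrank ℚ K) *
      √|(NumberField.discr K : ℝ)|)⌋₊ ≤ 12 :=
    Nat.le_of_lt_succ ((Nat.floor_lt (by positivity)).2 hM)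
  -- the unramified primes: `p^f > 12` with `f` the order of `p` modulo `20`
  have key : ∀ p : ℕ, p.Prime → ¬ p ∣ 20 →
      ⌊(4 / π) ^ nrComplexPlaces K * ((Module.finrank ℚ K)! / (Module.finrank ℚ K) ^ (Module.finrank ℚ K) *
        √|(NumberField.discr K : ℝ)|)⌋₊ < p ^ orderOf (p : ZMod 20) →
      ∃ P ∈ primesOver (span {(p : ℤ)}) (𝓞 K),
        ⌊(4 / π) ^ nrComplexPlaces K * ((Module.finrank ℚ K)! / (Module.finrank ℚ K) ^ (Module.finrank ℚ K) *
          √|(NumberField.discr K : ℝ)|)⌋₊ < p ^ P.inertiaDeg ℤ ∨ Submodule.IsPrincipal P := by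
    intro p hp hdvd hlt
    haveI : Fact p.Prime := ⟨hp⟩
    obtain ⟨⟨P, hP⟩⟩ := (Ideal.span {(p : ℤ)}).nonempty_primesOver (S := 𝓞 K)
    refine ⟨P, hP, Or.inl ?_⟩
    haveI := hP.1
    haveI := hP.2
    rwa [inertiaDeg_eq_of_not_dvd p K P (m := 20) hdvd]
  apply RingOfIntegers.isPrincipalIdealRing_of_isPrincipal_of_lt_or_isPrincipal_of_mem_primesOver_of_mem_Icc
  intro p hp hpp
  have hp12 : p ≤ 12 := (Finset.mem_Icc.1 hp).2.trans hfloor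
  have hp2 : 2 ≤ p := hpp.two_le
  interval_cases p
  · -- `p = 2`: `20 = 2² · 5`, residue degree `ord₅(2) = 4`, `2⁴ = 16 > 12`
    haveI : Fact (Nat.Prime 2) := ⟨Nat.prime_two⟩
    obtain ⟨⟨P, hP⟩⟩ := (Ideal.span {((2 : ℕ) : ℤ)}).nonempty_primesOver (S := 𝓞 K)
    refine ⟨P, hP, Or.inl ?_⟩
    haveI := hP.1
    haveI := hP.2
    rw [inertiaDeg_eq 20 K P (p := 2) (k := 1) (m := 5) (by norm_num) (by norm_num), Nat.cast_ofNat, h2]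
    omega
  · exact key 3 hpp (by norm_num) (by rw [Nat.cast_ofNat, h3]; omega)
  · norm_num at hpp -- `4` is not prime
  · -- `p = 5`: residue degree `1`; the prime `(1 + ζ − ζ³)` above it is principal
    have hζ := IsCyclotomicExtension.zeta_spec 20 ℚ K
    exact ⟨_, span_one_add_zeta_sub_zeta_pow_three_mem_primesOver_twenty hζ, Or.inr ⟨_, rfl⟩⟩
  · norm_num at hpp -- `6` is not prime
  · exact key 7 hpp (by norm_num) (by rw [Nat.cast_ofNat, h7]; omega)
  · norm_num at hpp -- `8` is not prime
  · norm_num at hpp -- `9` is not prime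
  · norm_num at hpp -- `10` is not prime
  · exact key 11 hpp (by norm_num) (by rw [Nat.cast_ofNat, h11]; omega)
  · norm_num at hpp -- `12` is not prime

end Twenty

/-! ### Class number one, for an arbitrary model `K`, and for Mathlib's `CyclotomicField 20 ℚ` -/

/-- **EVERY `20`-TH CYCLOTOMIC EXTENSION `K/ℚ` HAS CLASS NUMBER ONE** (`𝓞_K = ℤ[ζ₂₀]` is a principal ideal domain): Minkowski's
bound `M_K < 13`, the splitting law for `2, 3, 7, 11` (norms `16, 81, 2401, 121`), and the principal prime `(1 + ζ − ζ³)` of norm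
`5` above `5`. [cite: Washington1997, Thm. 11.1] [cite: Marcus2018, Ch. 5 Thm. 37 Cor. 2 (p0107) and Ch. 3 Thm. 26 (p0064)]
[cite: MasleyMontgomery1976, Main Theorem] -/
theorem classNumber_eq_one_of_isCyclotomicExtension_twenty (K : Type) [Field K] [NumberField K]
    (hK : IsCyclotomicExtension {20} ℚ K) : classNumber K = 1 :=
  (classNumber_eq_one_iff (K := K)).2 (isPrincipalIdealRing_ringOfIntegers_twenty_aux K)

/-- **`ℤ[ζ₂₀]` IS A PRINCIPAL IDEAL DOMAIN**: for every primitive `20`-th root of unity `ζ` of a `20`-th cyclotomic extension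
`K/ℚ`, the order `ℤ[ζ]` (`= 𝓞_K`) is a principal ideal ring. [cite: Washington1997, Thm. 11.1] [cite: MasleyMontgomery1976, Main Theorem] -/
theorem isPrincipalIdealRing_adjoin_of_isPrimitiveRoot_twenty {K : Type} [Field K] [NumberField K]
    [IsCyclotomicExtension {20} ℚ K] {ζ : K} (hζ : IsPrimitiveRoot ζ 20) :
    IsPrincipalIdealRing (Algebra.adjoin ℤ ({ζ} : Set K)) :=
  haveI := isPrincipalIdealRing_ringOfIntegers_twenty_aux K
  IsPrincipalIdealRing.of_surjective hζ.adjoinEquivRingOfIntegers.symm hζ.adjoinEquivRingOfIntegers.symm.surjective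

/-- `CyclotomicField 20 ℚ` is a `20`-th cyclotomic extension of `ℚ` (Mathlib instance, recorded as a term). [folklore] -/
private theorem isCyclotomicExtension_cyclotomicField_twenty : IsCyclotomicExtension {20} ℚ (CyclotomicField 20 ℚ) :=
  CyclotomicField.isCyclotomicExtension 20 ℚ

/-- **The ring of integers of `CyclotomicField 20 ℚ` (`= ℤ[ζ₂₀]`) is a principal ideal domain.** [cite: Washington1997, Thm. 11.1]
[cite: MasleyMontgomery1976, Main Theorem] -/
theorem isPrincipalIdealRing_ringOfIntegers_cyclotomicField_twenty :
    IsPrincipalIdealRing (𝓞 (CyclotomicField 20 ℚ)) :=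
  haveI := isCyclotomicExtension_cyclotomicField_twenty
  isPrincipalIdealRing_ringOfIntegers_twenty_aux (CyclotomicField 20 ℚ)

/-- **`h(ℚ(ζ₂₀)) = 1`.** [cite: Washington1997, Thm. 11.1] [cite: MasleyMontgomery1976, Main Theorem] -/
theorem classNumber_cyclotomicField_twenty : classNumber (CyclotomicField 20 ℚ) = 1 :=
  (classNumber_eq_one_iff (K := CyclotomicField 20 ℚ)).2 isPrincipalIdealRing_ringOfIntegers_cyclotomicField_twenty

end Literature.NumberTheory.NumberFields

end
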